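import Summits.BirchSwinnertonDyer.Rank1Residual.X1.MuLambdaAlgebra
import Summits.BirchSwinnertonDyer.BirchSwinnertonDyer.Theorems.ErratumRoadFiveNonSurjCornerTwinMuAnCertificateShape
import HarnessLib

/-!
# Route `ErratumRoadFive`, crux 19065 `NonSurjCorner`, child 19948 `NonSurjCornerTwinMuAn`: the certificate index IS the
# Iwasawa λ-invariant — `μ(G) = 0 ∧ λ(G) = n₀` for the integral `G` with `ι G = ϖ·L` — so the shape theorems read in the
# b2b cell's `(μ, λ)` currency: λ odd `≥ 3` on split corner twins, λ even on non-split ones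
# (cell `bsd-stepL`, seat `bsd-stepL-corner5-p2` g7; `--supports 19948 --as helper`)

The b2b residual cell types Iwasawa invariants of elements of `Λ = ℤ_p⟦T⟧` by `X1.MuLambda.mu` ∕ `X1.MuLambda.lam`
(`MuLambdaAlgebra`: `g = p^{μ(g)}·pfree g`, `λ(g) = ord_T(pfree g mod p)`), and its census records `λ_an = n` as typed data.
19948's stubs speak of SOME unit coefficient of `ϖ·L`; this seat's shape theorems (p587429 ∕ p587950 ∕ p588611) speak of the
LEAST one, `n₀`. This file identifies the two: for `G ∈ Λ` whose first `n₀` coefficients have norm `< 1` and whose `n₀`-th is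
a unit, `μ(G) = 0` and `λ(G) = n₀` (`mu_eq_zero_and_lam_eq_of_firstUnitCoeff`; `red G ≠ 0`, `pfree G = G` by
`MuLambda.mu_eq_and_pfree_eq`, `PowerSeries.order_eq_nat` on the reduction). Hence, with Wuthrich's integral `G`
(`ι G = ϖ·L`, Cor. 18 by name), for the X11a twins of the corner: **`μ(G) = 0` is EQUIVALENT to the stub's `∃ n`, and then
`λ(G)` is odd and `≥ 3` at a split prime, even at a non-split prime (`= 0` iff the unit-value locus)** —
`NonSurjTwin.lam_odd_three_le_of_split`, `NonSurjTwin.lam_even_of_nonsplit`. HONEST FRAMING: theorems only (no definition,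
no named fact, no `sorry`); conditional by name as displayed; nothing closes (T7); BSD is proved for no class.
References: [Washington1997] §7.1; [GreenbergVatsal2000] (1)–(2); [MazurTateTeitelbaum1986Invent] §I.17–18; [Wuthrich2014] Cor. 18.
-/

set_option autoImplicit false
set_option linter.dupNamespace false

noncomputable section

open scoped Classical NumberField MatrixGroups ModularForm

/-! ### §1 `μ = 0` and `λ = n₀` from the first unit coefficient -/

namespace Summit.BirchSwinnertonDyer.Rank1Residual.X1.MuLambda

open Literature.NumberTheory.EllipticCurves

variable {p : ℕ} [Fact p.Prime]

/-- A coefficient of `G ∈ ℤ_p⟦T⟧` reduces to `0` in `𝔽_p` iff it has norm `< 1`. [folklore] -/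
theorem coeff_red_eq_zero_iff (G : IwasawaAlgebra p) (j : ℕ) :
    PowerSeries.coeff j (red G) = 0 ↔ ‖PowerSeries.coeff j G‖ < 1 := by
  rw [red, PowerSeries.coeff_map, IsLocalRing.residue_eq_zero_iff, ← PadicInt.mem_nonunits]
  rfl

/-- **`μ(G) = 0` and `λ(G) = n₀`** when the coefficients of `G ∈ Λ` below `n₀` have norm `< 1` and the `n₀`-th is a unit:
`red G ≠ 0`, so `G = p⁰·G` is the `p`-free decomposition (`mu_eq_and_pfree_eq`), and `ord_T(red G) = n₀`
(`PowerSeries.order_eq_nat`). [cite: Washington1997, §7.1 (Weierstrass preparation; μ and λ of a power series)]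
[cite: GreenbergVatsal2000, p. 2–3, (1)–(2)] -/
theorem mu_eq_zero_and_lam_eq_of_firstUnitCoeff (G : IwasawaAlgebra p) {n : ℕ}
    (hsmall : ∀ j < n, ‖PowerSeries.coeff j G‖ < 1) (hunit : ‖PowerSeries.coeff n G‖ = 1) :
    mu G = 0 ∧ lam G = n := by
  have hn : PowerSeries.coeff n (red G) ≠ 0 := by
    rw [Ne, coeff_red_eq_zero_iff, hunit]; exact lt_irrefl 1
  have hred : red G ≠ 0 := fun h0 ↦ hn (by rw [h0, map_zero])
  obtain ⟨hmu, hpf⟩ := mu_eq_and_pfree_eq (g := G) (g₀ := G) (a := 0) hred (by simp)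
  refine ⟨hmu, ?_⟩
  have hord : (red G).order = n :=
    PowerSeries.order_eq_nat.mpr ⟨hn, fun i hi ↦ (coeff_red_eq_zero_iff G i).mpr (hsmall i hi)⟩
  rw [lam, hpf, hord]
  rfl

/-- The same with the least witness phrased through `ι G = t·L` in `ℚ_p⟦T⟧` (`‖(x : ℚ_p)‖ = ‖x‖`): if `ι G = L'` and `n₀` is
the least index with `‖[T^{n₀}]L'‖ = 1`, then `μ(G) = 0 ∧ λ(G) = n₀`. [cite: Washington1997, §7.1] -/
theorem mu_eq_zero_and_lam_eq_find (G : IwasawaAlgebra p) {L' : PowerSeries ℚ_[p]}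
    (hG : iwasawaToPowerSeries p G = L')
    (h : ∃ n : ℕ, ‖PowerSeries.coeff n L'‖ = 1) : mu G = 0 ∧ lam G = Nat.find h := by
  have hcoe : ∀ j, ‖PowerSeries.coeff j L'‖ = ‖PowerSeries.coeff j G‖ := by
    intro j; rw [← hG, PowerSeries.coeff_map]; exact PadicInt.padic_norm_e_of_padicInt _
  refine mu_eq_zero_and_lam_eq_of_firstUnitCoeff G (fun j hj ↦ ?_) (by rw [← hcoe]; exact Nat.find_spec h)
  have hle : ‖PowerSeries.coeff j G‖ ≤ 1 := (PowerSeries.coeff j G).norm_le_one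
  have hne : ‖PowerSeries.coeff j L'‖ ≠ 1 := Nat.find_min h hj
  rw [hcoe] at hne
  exact lt_of_le_of_ne hle hne

/-- Conversely `μ(G) = 0` gives a unit coefficient of `ι G` (so, for 19948: **the stub's `∃ n` ⟺ `μ = 0` of Wuthrich's `G`**).
[cite: GreenbergVatsal2000, p. 2, (2)] -/
theorem exists_norm_coeff_eq_one_of_mu_eq_zero {G : IwasawaAlgebra p} (hG0 : G ≠ 0) (hmu : mu G = 0) :
    ∃ n : ℕ, ‖PowerSeries.coeff n (iwasawaToPowerSeries p G)‖ = 1 := by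
  have hpf : pfree G = G := by
    have h := eq_C_pow_mu_mul_pfree G
    rw [hmu, pow_zero, map_one, one_mul] at h
    exact h.symm
  have hred : red G ≠ 0 := by rw [← hpf]; exact red_pfree_ne_zero hG0
  obtain ⟨n, hn⟩ : ∃ n, PowerSeries.coeff n (red G) ≠ 0 := by
    by_contra h
    push Not at h
    exact hred (PowerSeries.ext fun n ↦ by rw [h n, map_zero])
  refine ⟨n, ?_⟩
  have hc : ‖PowerSeries.coeff n (iwasawaToPowerSeries p G)‖ = ‖PowerSeries.coeff n G‖ := by
    rw [PowerSeries.coeff_map]; exact PadicInt.padic_norm_e_of_padicInt _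
  rw [hc]
  have hlt : ¬ ‖PowerSeries.coeff n G‖ < 1 := fun hlt ↦ hn ((coeff_red_eq_zero_iff G n).mpr hlt)
  exact le_antisymm (PowerSeries.coeff n G).norm_le_one (not_lt.mp hlt)

end Summit.BirchSwinnertonDyer.Rank1Residual.X1.MuLambda

/-! ### §2 The corner twins in `(μ, λ)` currency -/

namespace Summit.BirchSwinnertonDyer.BirchSwinnertonDyer.Theorems.TatePow

open CongruenceSubgroup PowerSeries WeierstrassCurve IsDedekindDomain Rat.HeightOneSpectrum
  Literature.NumberTheory.EllipticCurves Literature.NumberTheory.EllipticCurves.ModularForms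
  Literature.NumberTheory.EllipticCurves.Rank1Residual Summit.BirchSwinnertonDyer.Rank1Residual
  Summit.BirchSwinnertonDyer.Rank1Residual.X1.MuLambda

variable {W : WeierstrassCurve ℚ} [W.IsElliptic] [W.IsGloballyMinimal] {p : ℕ} [Fact p.Prime]
  {N : ℕ} [NeZero N] {f : CuspForm (Gamma0 N) 2}

/-- **Split corner twin: `λ(G)` is odd and `≥ 3`** for the integral `G` with `ι G = ϖ·L` (Wuthrich's; any such `G`), granted
`μ(G) = 0` in the form of the stub's `∃ n` — binders of `NonSurjTwin.three_le_find_of_split_noDatum`.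
[cite: MazurTateTeitelbaum1986Invent, §I.15, §I.17 and §I.18] [cite: GreenbergVatsal2000, (1)–(2)] -/
theorem NonSurjTwin.lam_odd_three_le_of_split
    (hWu : Wuthrich2014.corollary18_padicLFunction_mem_iwasawaAlgebra_multiplicative) (hmod : exists_isNewformOf)
    (hGZK : rank_eq_analyticRank_of_analyticRank_le_one) (hGS : greenberg_stevens (W := W) (p := p))
    (hXa : ClassX11a W p) (hnsj : ¬ Surj W p) (h57 : p = 5 ∨ p = 7) (hsplit : W.HasSplitMultiplicativeReductionAtPrime p)
    (hf : IsNewformOf W f) {ϖ : ℚ} (hϖ : (ϖ : ℝ) * W.realPeriodRat = plusPeriod f)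
    {L : PowerSeries ℚ_[p]} (hL : IsMultPAdicLFunctionOf f p 1 L) {q : ℚ} (hq : shaAn W = (q : ℂ)) (hq0 : q ≠ 0)
    (hint : 0 ≤ padicValRat p q)
    (h : ∃ n : ℕ, ‖PowerSeries.coeff n (PowerSeries.C ((ϖ : ℚ) : ℚ_[p]) * L)‖ = 1)
    {G : IwasawaAlgebra p} (hG : iwasawaToPowerSeries p G = PowerSeries.C ((ϖ : ℚ) : ℚ_[p]) * L) :
    mu G = 0 ∧ 3 ≤ lam G ∧ Odd (lam G) := by
  obtain ⟨hmu, hlam⟩ := mu_eq_zero_and_lam_eq_find G hG h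
  obtain ⟨h3, hodd⟩ := NonSurjTwin.three_le_find_of_split_noDatum hWu hmod hGZK hGS hXa hnsj h57 hsplit hf hϖ hL hq hq0 hint h
  exact ⟨hmu, hlam ▸ h3, hlam ▸ hodd⟩

/-- **Non-split corner twin: `λ(G)` is even, and `λ(G) = 0` iff the unit-value locus** (`ord_p #Ш_an = 0 ∧` no split place),
for the integral `G` with `ι G = ϖ·L`, granted the stub's `∃ n`. [cite: MazurTateTeitelbaum1986Invent, §I.10, §I.17 and §I.18]
[cite: GreenbergVatsal2000, (1)–(2)] -/
theorem NonSurjTwin.lam_even_of_nonsplit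
    (hWu : Wuthrich2014.corollary18_padicLFunction_mem_iwasawaAlgebra_multiplicative) (hmod : exists_isNewformOf)
    (hGZK : rank_eq_analyticRank_of_analyticRank_le_one) (hXa : ClassX11a W p) (hnsj : ¬ Surj W p)
    (h57 : p = 5 ∨ p = 7) (hns : ¬ W.HasSplitMultiplicativeReductionAtPrime p) (hf : IsNewformOf W f) {ϖ : ℚ}
    (hϖ : (ϖ : ℝ) * W.realPeriodRat = plusPeriod f) {L : PowerSeries ℚ_[p]} (hL : IsMultPAdicLFunctionOf f p (-1) L)
    {q : ℚ} (hq : shaAn W = (q : ℂ)) (hq0 : q ≠ 0) (hint : 0 ≤ padicValRat p q)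
    (h : ∃ n : ℕ, ‖PowerSeries.coeff n (PowerSeries.C ((ϖ : ℚ) : ℚ_[p]) * L)‖ = 1)
    {G : IwasawaAlgebra p} (hG : iwasawaToPowerSeries p G = PowerSeries.C ((ϖ : ℚ) : ℚ_[p]) * L) :
    mu G = 0 ∧ Even (lam G) ∧
      (lam G = 0 ↔ (padicValRat p q = 0 ∧ ∀ v : HeightOneSpectrum (𝓞 ℚ), ¬ W.HasSplitMultiplicativeReductionAt v)) := by
  obtain ⟨hmu, hlam⟩ := mu_eq_zero_and_lam_eq_find G hG h
  obtain ⟨h0, hne⟩ := NonSurjTwin.find_nonsplit_shape hWu hmod hGZK hXa hnsj h57 hns hf hϖ hL hq hq0 hint h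
  refine ⟨hmu, ?_, hlam ▸ h0⟩
  by_cases hz : Nat.find h = 0
  · rw [hlam, hz]; exact ⟨0, rfl⟩
  · exact hlam ▸ (hne hz).2

end Summit.BirchSwinnertonDyer.BirchSwinnertonDyer.Theorems.TatePow

end
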